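import Summits.QuantumFields.YangMills.Theorems.UnitScaleTiltProp7AxialReprPrint
import HarnessLib

/-!
# Route `UnitScaleTilt`, crux K1 child «MinimiserStabilityRegPr» (stmt-QuantumFields-19200), registered stub `stub_prop7From14` (skeleton birth_v7
# cc37a178…; leaf V3), pillar P-V3-A′ — DICTIONARY FILE: **[Balaban1985Variational] (19) AT THE T³ CARRIER FROM [Balaban1985RegularSpaces] THM 2's
# CONCLUSION (1.36) ∕ (1.39) READ ON A BASED PULLBACK** — the covariant one-form calculus (1.1)–(1.2) of the `ℤᵈ` lane (`B8Ineq132.covDerivFwd`,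
# `B8Eq146AExpansion.plaqCovDeriv`, `B8Eq143PlaqExpansion.pdiv`, `B8Eq138LandauZd.covLap`) on the periodic pullback based at ANY torus site `y` IS
# the torus calculus of `T3SectALandauChart` §2 (`covGradT`, `covCurlT`, `covCodiffCurlT`, `covLapFormT`) at `y + z`; hence `C136T ∧ C139T` for
# `(U₀♯_y, A♯_y)` give `T3SectALandauChart.In19 ε₂ U₀ U₁ (ηA)` for every `U₁ = e^{iηA}` bondwise, `ε₂ ≥ B₁(α₀ + α₁)` — with the TRACELESSNESS of
# `ηA` (the `𝔰𝔲(2)` clause of (19), not a clause of `Concl2Setup`) PROVED from `e^{iηA(b)} ∈ SU(2)` and `‖ηA(b)‖ ≤ 1` (Liouville's formula)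

Cell `ym3-torus` ∕ width seat `ym-ust-19200-w1` (gen 0; D-0149).  WHY.  The v8 pillar P-V3-A′ = `B11.Prop2Printed … (famLG3 L (Prop7SPrint.sPrint L T))`
(OWNER RULING g23-№3) is [Balaban1985RegularSpaces] Thm 2 for print's BASED letters; Thm 2's typed conclusion (`B8Thm2SetupTorus.Concl2Setup` ∕
`B8Thm2TorusAt.Concl2T`) speaks the `ℤᵈ` lane's letters `C136T` (1.36), `C139T` (1.39) on pullbacks, while Prop. 2's conclusion at the T³ carrier
speaks `T3SectALandauChart.In19` ((19) with body: `X = ηA` Hermitian traceless, `U₁ = e^{iX}`, `‖X‖ < ε₂η`, `‖∇¹_{U₀}X‖ < ε₂η²`, `‖D^{1*}_{U₀}D¹_{U₀}X‖,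
‖Δ¹_{U₀}X‖ < ε₂η³`).  This file is the dictionary between the two (RULING g23-№3 (c1): one convention, every letter on the based pullback).

WHAT IS PROVED (sorry-free, no definition).
§1 THE PULLBACK DICTIONARY at any base point `y` of any torus `T^{(s)}` (`𝔸` a complete normed `ℂ`-algebra): `covDerivFwd_pull` ((1.1)₁:
   `D^η_{V♯,μ}(G ∘ τ_y) = (D^η_{V,μ}G) ∘ τ_y`), `covGradT_pull` (`∇`), `plaqCovDeriv_pull` ([B9] (3.4) = the covariant curl `covCurlT`),
   `pdiv_plaqCovDeriv_pull` (`D^{η*}_{U₀}D^η_{U₀}` = `covCodiffCurlT`), `covLap_pull` (`Δ^η_{U₀}` = `covLapFormT`) — companions of the tree's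
   `B10Eq68TorusRegularity.covDeriv_pull` ∕ `covDiv_pull`.
§2 SCALING on the torus side: the operators are linear under `X ↦ c·X` (`covGradT_smul`, `covCurlT_smul`, `covCodiffCurlT_smul`, `covLapFormT_smul`)
   and `D^η = η⁻¹D¹` at second order (`covDerivT_eq_smul`, `covCodiffCurlT_eq_smul`, `covLapFormT_eq_smul`; first order is the tree's
   `T3SectALandauChart.covGradT_eq_smul`).
§3 `trace_eq_zero_of_exp_mem_SU2`: **`tr X = 0` for `X ∈ M₂(ℂ)` with `e^{iX} ∈ SU(2)` and `‖X‖ ≤ 1`** (`det e^{iX} = e^{i tr X} = 1` by Liouville's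
   formula `Literature.Analysis.Matrix.det_exp_eq_exp_trace`, so `tr X ∈ 2πℤ`; `|tr X| ≤ 2‖X‖ ≤ 2 < 2π`); `pow_mul_eta` (`Lᵏ·η = 1`, `η = L^{−k}`).
§4 **`in19_of_based136_139`** — THE MAIN DICTIONARY: for a member (`F`, heights `n`, `K`, `k = K − n`, `η = L^{−k}`), a base point `y`, `SU(2)`
   fields `U₀`, `U₁`, a torus one-form `A` with `A(b)` self-adjoint and `U₁(b) = e^{iηA(b)}` bondwise, if `C136T L k η β₀ B₁ B₂ len s (U₀♯_y) (A♯_y)` and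
   `C139T L k η B₁ s (U₀♯_y) (A♯_y)` hold ([6] (1.36), (1.39) for the based pullbacks; `U₀♯ = pull (bgUnits U₀) y`) with `B₁s ≤ 1` and `B₁s ≤ ε₂`,
   then `In19 F n K ε₂ U₀ U₁ (ηA)` — print's «U₁ satisfying the conditions (19) … with ε₂ ≧ B₁(ε₀ + C₁ε₁)» (p. 281), the `j = k` member of (1.36) ∕ (1.39)
   being (19)'s (`Lᵏη = 1`).

HONEST SCOPE.  Bookkeeping between two typings of the same printed operators; no estimate of Bałaban's is proved or assumed (`C136T`, `C139T` are
HYPOTHESES — conjuncts of Thm 2's typed conclusion).  The Hölder member of (1.36) and (1.37) are not used by (19) (print: «ε₂ ≧ B₁(ε₀ + C₁ε₁)» uses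
`B₁`'s members only; `T3SectALandauChart` (e)).  Count-neutral helper toward stmt-QuantumFields-19200 (`--supports`), not a proof of the stub; nothing
continuum ∕ OS ∕ mass-gap ∕ Clay (YM₃ on T³ is ladder rung R3).

References: T. Bałaban, CMP **102** (1985) 277–309 [Balaban1985Variational] ((19) p.281, Prop. 2 p.281); CMP **99** (1985) 75–102
[Balaban1985RegularSpaces] ((1.1)–(1.2) p.76, (1.36) p.82, (1.39) p.83, Thm 2 p.83); CMP **102** (1985) 255–275 [Balaban1985BackgroundPropagators]
((3.4) p.391, (3.23) p.394); CMP **98** (1985) 17–51 [Balaban1985Averaging] ((19)–(23) p.21).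
-/

noncomputable section

namespace Summit.QuantumFields.YangMills.Theorems.Prop7SPrintIn19

open NormedSpace
open Literature.MathematicalPhysics.QuantumFieldTheory.Balaban1983to89
open B7Prop1Explicit renaming Site → LSite
open B7Prop1Explicit (e)
open B7Eq78Linearization (conjR conjR_smul_real)
open B8Ineq132 (covDerivFwd covDeriv)
open B8Eq138LandauZd (covLap covDivB)
open B8Eq143PlaqExpansion (pdiv)
open B8Eq146AExpansion (plaqCovDeriv plaqCovDeriv_eq_covDerivFwd)
open B8Thm2TorusAt (C136T C139T)
open B10Eq27TorusAxialLog (transl transl_add_e transl_rel rel pull pull_apply unitsField toUField)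
open B10Eq68TorusRegularity (covDerivT covDeriv_pull)
open T3SectALandauChart (covDerivFwdT formComp covGradT covCurlT covCodiffT covCodiffCurlT covLapFormT covGradT_eq_smul covCurlT_eq_smul
  eta eta_pos bgUnits In19)

/-! ## §1 The pullback dictionary for the covariant one-form calculus (any torus, any base point) -/

section Pullback

variable {P : Params} {s : ℕ} {𝔸 : Type*} [NormedRing 𝔸] [NormedAlgebra ℂ 𝔸]

/-- **DICTIONARY, (1.1)₁**: the `ℤᵈ` forward covariant derivative of the pulled-back function along the pulled-back configuration is the torus forward
covariant derivative (`transl y (z + e_μ) = (y + z) + e_μ`). [cite: Balaban1985RegularSpaces, (1.1) p.76] -/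
theorem covDerivFwd_pull (η : ℝ) (V : GaugeField P s 𝔸ˣ) (y : Site P s) (μ : Fin P.d) (G : Site P s → 𝔸) (z : LSite P.d) :
    covDerivFwd η (pull V y) μ (fun z' => G (transl y z')) z = covDerivFwdT η V μ G (transl y z) := by
  unfold covDerivFwd covDerivFwdT
  simp only [pull_apply, transl_add_e]

/-- **DICTIONARY, `∇^η_{U₀}A`**: the `(μ, ν)` covariant gradient of the pulled-back one-form `A♯_y` along `V♯_y` at `z` is `covGradT η V A μ ν (y + z)`.
[cite: Balaban1985Variational, (19) p.281; Balaban1985RegularSpaces, (1.36) p.82] -/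
theorem covGradT_pull (η : ℝ) (V : GaugeField P s 𝔸ˣ) (X : PBond P s → 𝔸) (y : Site P s) (μ ν : Fin P.d) (z : LSite P.d) :
    covDerivFwd η (pull V y) μ (fun z' => pull X y z' ν) z = covGradT η V X μ ν (transl y z) :=
  covDerivFwd_pull η V y μ (formComp X ν) z

/-- **DICTIONARY, [B9] (3.4) = the covariant curl**: `plaqCovDeriv η V♯_y A♯_y μ ν z = covCurlT η V A μ ν (y + z)` (`plaqCovDeriv_eq_covDerivFwd`).
[cite: Balaban1985BackgroundPropagators, (3.4) p.391; Balaban1985RegularSpaces, (1.47) p.84] -/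
theorem plaqCovDeriv_pull (η : ℝ) (V : GaugeField P s 𝔸ˣ) (X : PBond P s → 𝔸) (y : Site P s) (μ ν : Fin P.d) (z : LSite P.d) :
    plaqCovDeriv η (pull V y) (pull X y) μ ν z = covCurlT η V X μ ν (transl y z) := by
  rw [plaqCovDeriv_eq_covDerivFwd, covCurlT, covGradT_pull, covGradT_pull]

/-- **DICTIONARY, `D^{η*}_{U₀}D^η_{U₀}A`** ((1.2) of the covariant curl): `pdiv η V♯_y (plaqCovDeriv η V♯_y A♯_y) μ z = covCodiffCurlT η V A μ (y + z)`.
[cite: Balaban1985RegularSpaces, (1.2) p.76, (1.39) p.83] -/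
theorem pdiv_plaqCovDeriv_pull (η : ℝ) (V : GaugeField P s 𝔸ˣ) (X : PBond P s → 𝔸) (y : Site P s) (μ : Fin P.d) (z : LSite P.d) :
    pdiv η (pull V y) (plaqCovDeriv η (pull V y) (pull X y)) μ z = covCodiffCurlT η V X μ (transl y z) := by
  have hF : ∀ κ κ' : Fin P.d, plaqCovDeriv η (pull V y) (pull X y) κ κ' = fun z' => covCurlT η V X κ κ' (transl y z') :=
    fun κ κ' => funext (plaqCovDeriv_pull η V X y κ κ')
  unfold pdiv covCodiffCurlT covCodiffT
  simp only [hF, covDeriv_pull]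

/-- **DICTIONARY, `Δ^η_{U₀}A`** (componentwise covariant Laplacian [B9] (3.23)): `covLap η V♯_y (A♯_y)_κ z = covLapFormT η V A κ (y + z)`.
[cite: Balaban1985BackgroundPropagators, (3.23) p.394; Balaban1985RegularSpaces, (1.39) p.83] -/
theorem covLap_pull (η : ℝ) (V : GaugeField P s 𝔸ˣ) (X : PBond P s → 𝔸) (y : Site P s) (κ : Fin P.d) (z : LSite P.d) :
    covLap η (pull V y) (fun z' => pull X y z' κ) z = covLapFormT η V X κ (transl y z) := by
  have h : ∀ μ : Fin P.d, (fun z' => covDerivFwd η (pull V y) μ (fun z'' => pull X y z'' κ) z') =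
      fun z' => covDerivFwdT η V μ (formComp X κ) (transl y z') :=
    fun μ => funext fun z' => covGradT_pull η V X y μ κ z'
  unfold covLap covDivB covLapFormT
  simp only [h, covDeriv_pull]

end Pullback

/-! ## §2 Scaling on the torus side -/

section Scaling

variable {P : Params} {s : ℕ} {𝔸 : Type*} [NormedRing 𝔸] [NormedAlgebra ℂ 𝔸]

/-- `D^η_{V,μ}(cG) = c·D^η_{V,μ}G` (real `c`). [cite: Balaban1985RegularSpaces, (1.1) p.76] -/
theorem covDerivFwdT_smul (η c : ℝ) (V : GaugeField P s 𝔸ˣ) (μ : Fin P.d) (G : Site P s → 𝔸) (x : Site P s) :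
    covDerivFwdT η V μ (fun x' => c • G x') x = c • covDerivFwdT η V μ G x := by
  unfold covDerivFwdT
  rw [conjR_smul_real, ← smul_sub, smul_comm]

/-- `D^{η*}_{V,ν}(cF) = c·D^{η*}_{V,ν}F` (real `c`). [cite: Balaban1985RegularSpaces, (1.1) p.76] -/
theorem covDerivT_smul (η c : ℝ) (V : GaugeField P s 𝔸ˣ) (ν : Fin P.d) (F : Site P s → 𝔸) (x : Site P s) :
    covDerivT η V ν (fun x' => c • F x') x = c • covDerivT η V ν F x := by
  unfold covDerivT
  rw [conjR_smul_real, ← smul_sub, smul_comm]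

/-- `∇^η_V(cX) = c·∇^η_V X`. [cite: Balaban1985Variational, (19) p.281] -/
theorem covGradT_smul (η c : ℝ) (V : GaugeField P s 𝔸ˣ) (X : PBond P s → 𝔸) (μ ν : Fin P.d) (x : Site P s) :
    covGradT η V (fun b => c • X b) μ ν x = c • covGradT η V X μ ν x :=
  covDerivFwdT_smul η c V μ (formComp X ν) x

/-- `D^η_V(cX) = c·D^η_V X` on plaquettes. [cite: Balaban1985RegularSpaces, (1.47) p.84] -/
theorem covCurlT_smul (η c : ℝ) (V : GaugeField P s 𝔸ˣ) (X : PBond P s → 𝔸) (μ ν : Fin P.d) (x : Site P s) :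
    covCurlT η V (fun b => c • X b) μ ν x = c • covCurlT η V X μ ν x := by
  simp only [covCurlT, covGradT_smul, smul_sub]

/-- `D^{η*}_V D^η_V (cX) = c·D^{η*}_V D^η_V X`. [cite: Balaban1985RegularSpaces, (1.39) p.83] -/
theorem covCodiffCurlT_smul (η c : ℝ) (V : GaugeField P s 𝔸ˣ) (X : PBond P s → 𝔸) (μ : Fin P.d) (x : Site P s) :
    covCodiffCurlT η V (fun b => c • X b) μ x = c • covCodiffCurlT η V X μ x := by
  have hc : covCurlT η V (fun b => c • X b) = fun μ' ν' x' => c • covCurlT η V X μ' ν' x' := by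
    funext μ' ν' x'; exact covCurlT_smul η c V X μ' ν' x'
  unfold covCodiffCurlT covCodiffT
  simp only [hc, covDerivT_smul, ← Finset.smul_sum, smul_sub]

/-- `Δ^η_V (cX) = c·Δ^η_V X`. [cite: Balaban1985RegularSpaces, (1.39) p.83] -/
theorem covLapFormT_smul (η c : ℝ) (V : GaugeField P s 𝔸ˣ) (X : PBond P s → 𝔸) (ν : Fin P.d) (x : Site P s) :
    covLapFormT η V (fun b => c • X b) ν x = c • covLapFormT η V X ν x := by
  have h : ∀ μ : Fin P.d, covDerivFwdT η V μ (formComp (fun b => c • X b) ν) = fun x' => c • covDerivFwdT η V μ (formComp X ν) x' :=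
    fun μ => funext fun x' => covDerivFwdT_smul η c V μ (formComp X ν) x'
  unfold covLapFormT
  simp only [h, covDerivT_smul, ← Finset.smul_sum]

/-- `D^{η*}_{V,ν} = η⁻¹·D^{1*}_{V,ν}`. [cite: Balaban1985RegularSpaces, (1.1) p.76] -/
theorem covDerivT_eq_smul (η : ℝ) (V : GaugeField P s 𝔸ˣ) (ν : Fin P.d) (F : Site P s → 𝔸) (x : Site P s) :
    covDerivT η V ν F x = η⁻¹ • covDerivT 1 V ν F x := by
  simp only [covDerivT, inv_one, one_smul]

/-- `D^{η*}_V D^η_V = η⁻²·D^{1*}_V D¹_V`. [cite: Balaban1985RegularSpaces, (1.39) p.83] -/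
theorem covCodiffCurlT_eq_smul (η : ℝ) (V : GaugeField P s 𝔸ˣ) (X : PBond P s → 𝔸) (μ : Fin P.d) (x : Site P s) :
    covCodiffCurlT η V X μ x = η⁻¹ • η⁻¹ • covCodiffCurlT 1 V X μ x := by
  have hc : covCurlT η V X = fun μ' ν' x' => η⁻¹ • covCurlT 1 V X μ' ν' x' := by
    funext μ' ν' x'; exact covCurlT_eq_smul η V X μ' ν' x'
  unfold covCodiffCurlT covCodiffT
  rw [hc]
  simp only [covDerivT_smul, covDerivT_eq_smul η, ← Finset.smul_sum, smul_sub]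

/-- `Δ^η_V = η⁻²·Δ¹_V`. [cite: Balaban1985RegularSpaces, (1.39) p.83] -/
theorem covLapFormT_eq_smul (η : ℝ) (V : GaugeField P s 𝔸ˣ) (X : PBond P s → 𝔸) (ν : Fin P.d) (x : Site P s) :
    covLapFormT η V X ν x = η⁻¹ • η⁻¹ • covLapFormT 1 V X ν x := by
  have h : ∀ μ : Fin P.d, covDerivFwdT η V μ (formComp X ν) = fun x' => η⁻¹ • covDerivFwdT 1 V μ (formComp X ν) x' :=
    fun μ => funext fun x' => T3SectALandauChart.covDerivFwdT_eq_smul η V μ (formComp X ν) x'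
  unfold covLapFormT
  simp only [h, covDerivT_smul, covDerivT_eq_smul η, ← Finset.smul_sum]

end Scaling

/-! ## §3 Tracelessness of a small exponent of an `SU(2)` element; `Lᵏη = 1` -/

section Trace

open scoped Matrix.Norms.L2Operator

/-- **`tr X = 0` FOR `e^{iX} ∈ SU(2)`, `‖X‖ ≤ 1`**: Liouville's formula `det e^{iX} = e^{i tr X}` (`Literature.Analysis.Matrix.det_exp_eq_exp_trace`) and
`det = 1` put `tr X` in `2πℤ`; `|tr X| ≤ 2‖X‖ ≤ 2 < 2π` (`MatrixNorms.norm_ntr_le_opNorm`).  This is the `𝔰𝔲(2)` clause «A is 𝔤-valued» of (19),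
which [6] Thm 2's typed conclusion does not display. [cite: Balaban1985Averaging, (23) p.21; Balaban1985Variational, (19) p.281] -/
theorem trace_eq_zero_of_exp_mem_SU2 {X : Matrix (Fin 2) (Fin 2) ℂ}
    (hW : exp (Complex.I • X) ∈ Matrix.specialUnitaryGroup (Fin 2) ℂ) (hX : ‖X‖ ≤ 1) : X.trace = 0 := by
  letI : NormedAlgebra ℚ (Matrix (Fin 2) (Fin 2) ℂ) := NormedAlgebra.restrictScalars ℚ ℂ _
  have hdet : (exp (Complex.I • X)).det = 1 := (Matrix.mem_specialUnitaryGroup_iff.1 hW).2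
  have hexp : Complex.exp (Complex.I • X).trace = 1 := by
    rw [Complex.exp_eq_exp_ℂ, ← Literature.Analysis.Matrix.det_exp_eq_exp_trace]
    exact hdet
  obtain ⟨k, hk⟩ := Complex.exp_eq_one_iff.1 hexp
  rw [Matrix.trace_smul, smul_eq_mul] at hk
  -- `|tr X| ≤ 2‖X‖ ≤ 2`
  have htr : ‖X.trace‖ ≤ 2 := by
    have h := MatrixNorms.norm_ntr_le_opNorm X
    rw [MatrixNorms.ntr, Fintype.card_fin, norm_div, Complex.norm_natCast, Nat.cast_ofNat,
      div_le_iff₀ (by norm_num : (0 : ℝ) < 2)] at h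
    linarith
  have hI : ‖Complex.I * X.trace‖ = ‖X.trace‖ := by rw [norm_mul, Complex.norm_I, one_mul]
  have h2π : ‖(k : ℂ) * (2 * (Real.pi : ℂ) * Complex.I)‖ = |(k : ℝ)| * (2 * Real.pi) := by
    rw [norm_mul, Complex.norm_intCast]
    congr 1
    rw [norm_mul, norm_mul, Complex.norm_I, mul_one, Complex.norm_ofNat, Complex.norm_real, Real.norm_eq_abs,
      abs_of_pos Real.pi_pos]
  have hk0 : k = 0 := by
    have hlt : |(k : ℝ)| * (2 * Real.pi) < 1 * (2 * Real.pi) := by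
      rw [← h2π, ← hk, hI, one_mul]
      linarith [Real.pi_gt_three]
    have habs : |(k : ℝ)| < 1 := lt_of_mul_lt_mul_right hlt (by positivity)
    have : |k| < 1 := by exact_mod_cast habs
    exact Int.abs_lt_one_iff.mp this
  have hIX : Complex.I * X.trace = 0 := by rw [hk, hk0]; simp
  simpa [Complex.I_ne_zero] using hIX

open Literature.MathematicalPhysics.QuantumFieldTheory.Balaban1983to89.T3ContinuumYM3Torus

/-- **`Lᵏ·η = 1`** for `η = L^{−k}`, `k = K − n` (print's `Lʲη` at the top scale `j = k`: the (1.36) ∕ (1.39) thresholds at `j = k` are (19)'s).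
[cite: Balaban1985Variational, (19) p.281; Balaban1985RegularSpaces, (1.36) p.82] -/
theorem pow_mul_eta (F : T3Family) (n K : ℕ) : ((F.P K).L : ℝ) ^ (K - n) * eta F n K = 1 := by
  have hL : ((F.P K).L : ℝ) ≠ 0 := by
    show ((F.L : ℕ) : ℝ) ≠ 0
    exact_mod_cast (by have := F.hL.2; omega : F.L ≠ 0)
  show ((F.P K).L : ℝ) ^ (K - n) * (((F.L : ℕ) : ℝ)⁻¹) ^ (K - n) = 1
  rw [show ((F.L : ℕ) : ℝ) = ((F.P K).L : ℝ) from rfl, ← mul_pow, mul_inv_cancel₀ hL, one_pow]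

end Trace

/-! ## §4 (19) at the T³ carrier from (1.36) ∕ (1.39) on a based pullback -/

section Main

open scoped Matrix.Norms.L2Operator
open Literature.MathematicalPhysics.QuantumFieldTheory.Balaban1983to89.T3ContinuumYM3Torus

variable (F : T3Family) {n K : ℕ}

/-- **[Balaban1985Variational] (19) FROM [Balaban1985RegularSpaces] (1.36) ∕ (1.39) READ ON A BASED PULLBACK.**  Member `F`, heights `n`, `K`
(`k = K − n`, `η = L^{−k}`), base point `y`; `SU(2)` background `U₀` and perturbation `U₁`; a torus one-form `A` with `A(b)` self-adjoint and
`U₁(b) = e^{iηA(b)}` at every bond.  If the sup and gradient members of (1.36) (`C136T L k η β₀ B₁ B₂ len s`, smallness `s = α₀ + α₁`) and both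
members of (1.39) (`C139T L k η B₁ s`) hold for the pullbacks `U₀♯_y = pull (bgUnits U₀) y`, `A♯_y = pull A y`, and `B₁s ≤ 1`, `B₁s ≤ ε₂`, then
`X := ηA` satisfies (19) at the carrier: `In19 F n K ε₂ U₀ U₁ X` (Hermitian traceless, `U₁ = e^{iX}`, `‖X‖ < ε₂η`, `‖∇¹_{U₀}X‖ < ε₂η²`,
`‖D^{1*}_{U₀}D¹_{U₀}X‖, ‖Δ¹_{U₀}X‖ < ε₂η³`) — the `j = k` members of (1.36) ∕ (1.39) (`Lᵏη = 1`) through §1–§2, tracelessness through §3.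
Print, p. 281: «U₁ = U′^{u⁻¹} satisfies the conditions (1.36)–(1.39) of [6]. These gauge transformations define a mapping of the space (18) into a
space of gauge field configurations U₁U₀ with U₁ satisfying the conditions U₁ = e^{iηA}, |A| < ε₂(Lʲη)⁻¹, |∇^η_{U₀}A| < ε₂(Lʲη)⁻², |D^{η*}_{U₀}D^η_{U₀}A|,
|Δ^η_{U₀}A| < ε₂(Lʲη)⁻³ on Ω_j … (19) … with ε₂ ≧ B₁(ε₀ + C₁ε₁)».
[cite: Balaban1985Variational, (19) p.281, Prop. 2 p.281; Balaban1985RegularSpaces, (1.36) p.82, (1.39) p.83] -/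
theorem in19_of_based136_139 (y : Site (F.P K) 0) {β₀ B₁ B₂ s ε₂ : ℝ} {len : LSite (F.P K).d → ℝ}
    {U₀ U₁ : GaugeField (F.P K) 0 (Matrix.specialUnitaryGroup (Fin 2) ℂ)} {A : PBond (F.P K) 0 → Matrix (Fin 2) (Fin 2) ℂ}
    (hsa : ∀ b : PBond (F.P K) 0, IsSelfAdjoint (A b))
    (hexp : ∀ b : PBond (F.P K) 0,
      ((U₁ b : Matrix.specialUnitaryGroup (Fin 2) ℂ) : Matrix (Fin 2) (Fin 2) ℂ) = exp (Complex.I • ((eta F n K) • A b)))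
    (h36 : C136T (F.P K).L (K - n) (eta F n K) β₀ B₁ B₂ len s (pull (bgUnits F K U₀) y) (pull A y))
    (h39 : C139T (F.P K).L (K - n) (eta F n K) B₁ s (pull (bgUnits F K U₀) y) (pull A y))
    (hs1 : B₁ * s ≤ 1) (hε₂ : B₁ * s ≤ ε₂) :
    In19 F n K ε₂ U₀ U₁ (fun b => (eta F n K) • A b) := by
  -- abbreviations and the scale factor `Lᵏη = 1`
  have hη : 0 < eta F n K := eta_pos F n K
  have hη1 : eta F n K ≤ 1 := by
    unfold eta
    exact pow_le_one₀ (inv_nonneg.mpr (Nat.cast_nonneg _))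
      (inv_le_one_of_one_le₀ (by exact_mod_cast F.hL.2.le))
  have hone : (((F.P K).L : ℝ) ^ (K - n) * eta F n K)⁻¹ = 1 := by rw [pow_mul_eta, inv_one]
  -- every bond / site is reached from the base point
  have hbond : ∀ b : PBond (F.P K) 0, (⟨transl y (rel y b.src), b.dir⟩ : PBond (F.P K) 0) = b := fun b => by
    rw [transl_rel]
  -- the three printed members at `j = k`, read back on the torus
  have hA : ∀ b : PBond (F.P K) 0, ‖A b‖ < B₁ * s := by
    intro b
    have h := h36.1 (K - n) le_rfl (rel y b.src) b.dir
    rw [hone, mul_one, pull_apply, transl_rel] at h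
    exact h
  have hgrad : ∀ (μ ν : Fin (F.P K).d) (x : Site (F.P K) 0), ‖covGradT (eta F n K) (bgUnits F K U₀) A μ ν x‖ < B₁ * s := by
    intro μ ν x
    have h := h36.2.1 (K - n) le_rfl (rel y x) μ ν
    rw [hone, one_pow, mul_one, covGradT_pull, transl_rel] at h
    exact h
  have hcodiff : ∀ (μ : Fin (F.P K).d) (x : Site (F.P K) 0), ‖covCodiffCurlT (eta F n K) (bgUnits F K U₀) A μ x‖ < B₁ * s := by
    intro μ x
    have h := h39.1 (K - n) le_rfl (rel y x) μ
    rw [hone, one_pow, mul_one, pdiv_plaqCovDeriv_pull, transl_rel] at h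
    exact h
  have hlap : ∀ (ν : Fin (F.P K).d) (x : Site (F.P K) 0), ‖covLapFormT (eta F n K) (bgUnits F K U₀) A ν x‖ < B₁ * s := by
    intro ν x
    have h := h39.2 (K - n) le_rfl (rel y x) ν
    rw [hone, one_pow, mul_one, covLap_pull, transl_rel] at h
    exact h
  have hnormη : ‖(eta F n K)‖ = eta F n K := Real.norm_of_nonneg hη.le
  refine ⟨fun b => ⟨?_, ?_⟩, hexp, fun b => ?_, fun μ ν x => ?_, fun μ x => ?_, fun ν x => ?_⟩
  · -- Hermitian
    show Matrix.conjTranspose (eta F n K • A b) = eta F n K • A b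
    have h := hsa b
    rw [IsSelfAdjoint, Matrix.star_eq_conjTranspose] at h
    rw [Matrix.conjTranspose_smul, star_trivial, h]
  · -- traceless: `e^{iX(b)} = U₁(b) ∈ SU(2)`, `‖X(b)‖ ≤ 1`
    refine trace_eq_zero_of_exp_mem_SU2 (X := eta F n K • A b) ?_ ?_
    · rw [← hexp b]; exact (U₁ b).2
    · rw [norm_smul, hnormη]
      calc eta F n K * ‖A b‖ ≤ 1 * (B₁ * s) := mul_le_mul hη1 (hA b).le (norm_nonneg _) zero_le_one
        _ ≤ 1 := by rw [one_mul]; exact hs1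
  · -- sup member
    rw [norm_smul, hnormη, mul_comm]
    exact lt_of_lt_of_le (mul_lt_mul_of_pos_right (hA b) hη) (mul_le_mul_of_nonneg_right hε₂ hη.le)
  · -- gradient member: `∇¹(ηA) = η·∇¹A = η²·∇^ηA`
    have h1 : covGradT 1 (bgUnits F K U₀) (fun b => eta F n K • A b) μ ν x =
        (eta F n K * eta F n K) • covGradT (eta F n K) (bgUnits F K U₀) A μ ν x := by
      rw [covGradT_smul, covGradT_eq_smul (eta F n K), smul_smul]
      congr 1
      field_simp
    rw [h1, norm_smul, Real.norm_of_nonneg (by positivity), ← sq, mul_comm]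
    exact lt_of_lt_of_le (mul_lt_mul_of_pos_right (hgrad μ ν x) (by positivity)) (mul_le_mul_of_nonneg_right hε₂ (by positivity))
  · -- `D*D` member: `D^{1*}D¹(ηA) = η·η²·D^{η*}D^η A`
    have h1 : covCodiffCurlT 1 (bgUnits F K U₀) (fun b => eta F n K • A b) μ x =
        (eta F n K * (eta F n K * eta F n K)) • covCodiffCurlT (eta F n K) (bgUnits F K U₀) A μ x := by
      rw [covCodiffCurlT_smul, covCodiffCurlT_eq_smul (eta F n K), smul_smul, smul_smul]
      congr 1
      field_simp
    rw [h1, norm_smul, Real.norm_of_nonneg (by positivity), mul_comm,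
      show eta F n K * (eta F n K * eta F n K) = eta F n K ^ 3 by ring]
    exact lt_of_lt_of_le (mul_lt_mul_of_pos_right (hcodiff μ x) (by positivity)) (mul_le_mul_of_nonneg_right hε₂ (by positivity))
  · -- Laplacian member
    have h1 : covLapFormT 1 (bgUnits F K U₀) (fun b => eta F n K • A b) ν x =
        (eta F n K * (eta F n K * eta F n K)) • covLapFormT (eta F n K) (bgUnits F K U₀) A ν x := by
      rw [covLapFormT_smul, covLapFormT_eq_smul (eta F n K), smul_smul, smul_smul]
      congr 1
      field_simp
    rw [h1, norm_smul, Real.norm_of_nonneg (by positivity), mul_comm,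
      show eta F n K * (eta F n K * eta F n K) = eta F n K ^ 3 by ring]
    exact lt_of_lt_of_le (mul_lt_mul_of_pos_right (hlap ν x) (by positivity)) (mul_le_mul_of_nonneg_right hε₂ (by positivity))

end Main

end Summit.QuantumFields.YangMills.Theorems.Prop7SPrintIn19

end
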